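import Literature.NumberTheory.EllipticCurves.LocalTorsionDivisionPolynomialCertificateAnyPrime
import Mathlib.NumberTheory.Padics.Hensel
import Mathlib.Algebra.Polynomial.Identities
import HarnessLib

/-!
# `E(ℚ_p)[p] ≠ 0` from a `decide`-able Hensel certificate on the `p`-division polynomial
# (Silverman, *AEC* Exercise 3.7(f) + Hensel's lemma; proofs only)

Companion of `LocalTorsionDivisionPolynomialCertificateProofs` /
`LocalTorsionDivisionPolynomialCertificateAnyPrime` (cell `bsd-litref` / `bsd-potss`), which decide
the TRIVIAL case `#E(ℚ_p)[p] = 1` («`preΨ'_p` has no zero modulo `p^k`»).  This file decides the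
opposite case — the `(t1)` rows of C.-H. Kim, Amer. J. Math. 148 (2026) Prop. 3.2, `E(ℚ_p)[p] ≠ 0` —
by an EXISTENCE certificate: for an integral equation `E₀/ℤ`, an odd prime `p`, integers `a, b` and
`s : ℕ` with

* (C1) `p^(2s+2) ∣ preΨ'_p(E₀)(a)`,
* (C2) `p^(2s+2) ∤ preΨ'_p(E₀)(a + p^(s+1))`,
* (C3) `p ∤ 2b + a₁a + a₃`,
* (C4) `p ∣ b² + a₁ab + a₃b − (a³ + a₂a² + a₄a + a₆)`,

(each ONE `decide` through the computable evaluator `PrePsiEval.prePsi`) there is a point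
`P ∈ E(ℚ_p)`, `P ≠ O`, with `p • P = O` (`exists_ne_zero_prime_smul_eq_zero_of_henselCertificate`);
hence `#{Q ∈ E(ℚ_p) : p • Q = O} ≠ 1` (`natCard_localPTorsion_ne_one_of_henselCertificate`), the
negation of the `(t0)` binder shape `natCard_localPTorsion_eq_one_of_certificate`.

Proof.  Write `F = preΨ'_p(E₀) ∈ ℤ[X]`, `d = F'(a)`.  By the binomial expansion
`F(a + h) = F(a) + d·h + k·h²` (Mathlib `Polynomial.binomExpansion`) with `h = p^(s+1)`, (C1) and
(C2) force `p^(s+1) ∤ d`, so in `ℤ_p`: `‖F(a)‖ ≤ p^{-(2s+2)} < ‖d‖²` and Hensel's lemma (Mathlib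
`hensels_lemma`) gives `ξ ∈ ℤ_p` with `F(ξ) = 0`, `‖ξ − a‖ < 1`.  Then
`G(Y) = Y² + (a₁ξ + a₃)Y − (ξ³ + a₂ξ² + a₄ξ + a₆) ∈ ℤ_p[Y]` has `‖G(b)‖ < 1` (by (C4) and
`ξ ≡ a`) and `‖G'(b)‖ = ‖2b + a₁ξ + a₃‖ = 1` (by (C3)), so Hensel gives `η ∈ ℤ_p` with `G(η) = 0`,
i.e. `(ξ, η) ∈ E₀(ℤ_p)`.  Read in `ℚ_p` the point is nonsingular (`E` elliptic) and is killed by `p`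
because `ψ_p(ξ, η)² = ΨSq_p(ξ) = preΨ'_p(ξ)² = 0` (AEC Ex. 3.7(f), tree
`WeierstrassCurve.zsmul_some_eq_zero_iff_eval_ΨSq`).  (No derivative of `preΨ'_p` is ever
evaluated: (C2) replaces `v_p(F'(a)) = s` — this is what makes the certificate two evaluations of
`PrePsiEval.prePsi`.)

How to produce a certificate (outside the kernel): `ξ` = the `x`-coordinate of a point of order `p`
in `E₀(ℤ_p) ∖ E₁` (it reduces to a non-zero point of `Ẽ_ns(𝔽_p)`, so `2y + a₁x + a₃` is a `p`-unit
because `Ẽ_ns(𝔽_p)` has no `2`-torsion at an additive odd `p`), `s = v_p(F'(ξ))`,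
`a = ξ mod p^(s+2)`, `b = y mod p`.

`Proofs`-style file: THEOREMS ONLY (no definition, no named fact, no instance); nothing is asserted
about any particular curve; no `Summits/` file is touched.

## References
* J. H. Silverman, *The Arithmetic of Elliptic Curves*, 2nd ed., GTM 106 (2009), Exercise 3.7(d),(f)
  (PDF pp. 97–98). [SilvermanAEC2009]
* C.-H. Kim, Amer. J. Math. 148 (2026) = arXiv:2203.12159, §3.1, Prop. 3.2 (PDF p. 15): the locus
  `E(ℚ_p)[p] ≠ 0` (`t = 1`). [Kim2022StructureSelmer]
* Hensel's lemma as in Mathlib (`hensels_lemma`, K. Conrad's note).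
-/

noncomputable section

open scoped Classical

open Polynomial WeierstrassCurve

namespace Literature.NumberTheory.EllipticCurves

section HenselCertificate

variable (W₀ : WeierstrassCurve ℤ) (p : ℕ) [hp : Fact p.Prime]

/-- **The `x`-step input of Hensel's lemma from two values of `preΨ'_p`.** If
`p^(2s+2) ∣ preΨ'_p(E₀)(a)` and `p^(2s+2) ∤ preΨ'_p(E₀)(a + p^(s+1))`, then in `ℤ_p`
`‖preΨ'_p(a)‖ < ‖(preΨ'_p)'(a)‖²` — the binomial expansion
`F(a + h) = F(a) + F'(a)h + kh²` with `h = p^(s+1)` shows `p^(s+1) ∤ F'(a)`.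
[cite: SilvermanAEC2009, Exercise 3.7(d) (PDF pp. 97–98)] -/
theorem norm_aeval_preΨ'_lt_sq_of_certificate (a : ℤ) (s : ℕ)
    (hC1 : (p : ℤ) ^ (2 * s + 2) ∣ PrePsiEval.prePsi W₀ a p)
    (hC2 : ¬ (p : ℤ) ^ (2 * s + 2) ∣ PrePsiEval.prePsi W₀ (a + (p : ℤ) ^ (s + 1)) p) :
    ‖Polynomial.aeval (a : ℤ_[p]) (W₀.preΨ' p)‖ <
      ‖Polynomial.aeval (a : ℤ_[p]) (Polynomial.derivative (W₀.preΨ' p))‖ ^ 2 := by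
  set F : ℤ[X] := W₀.preΨ' p with hF
  rw [← PrePsiEval.eval_preΨ'] at hC1 hC2
  obtain ⟨k, hk⟩ := F.binomExpansion a ((p : ℤ) ^ (s + 1))
  -- `p^(s+1) ∤ F'(a)`
  have hd : ¬ (p : ℤ) ^ (s + 1) ∣ F.derivative.eval a := by
    intro hd
    apply hC2
    rw [hk]
    refine dvd_add (dvd_add hC1 ?_) ?_
    · have e : (p : ℤ) ^ (2 * s + 2) = (p : ℤ) ^ (s + 1) * (p : ℤ) ^ (s + 1) := by
        rw [← pow_add]; ring_nf
      rw [e]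
      exact mul_dvd_mul hd dvd_rfl
    · exact Dvd.intro_left k (by ring)
  -- read the two facts as norm bounds in `ℤ_p`
  have e1 : Polynomial.aeval (a : ℤ_[p]) F = ((F.eval a : ℤ) : ℤ_[p]) := by
    rw [← eq_intCast (algebraMap ℤ ℤ_[p]) a, Polynomial.aeval_algebraMap_apply_eq_algebraMap_eval,
      eq_intCast]
  have e2 : Polynomial.aeval (a : ℤ_[p]) (Polynomial.derivative F) =
      ((F.derivative.eval a : ℤ) : ℤ_[p]) := by
    rw [← eq_intCast (algebraMap ℤ ℤ_[p]) a, Polynomial.aeval_algebraMap_apply_eq_algebraMap_eval,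
      eq_intCast]
  have h1 : ‖((F.eval a : ℤ) : ℤ_[p])‖ ≤ (p : ℝ) ^ (-((2 * s + 2 : ℕ) : ℤ)) :=
    PadicInt.norm_int_le_pow_iff_dvd.mpr (by exact_mod_cast hC1)
  have h2 : ¬ ‖((F.derivative.eval a : ℤ) : ℤ_[p])‖ ≤ (p : ℝ) ^ (-((s + 1 : ℕ) : ℤ)) :=
    fun h => hd (by exact_mod_cast (PadicInt.norm_int_le_pow_iff_dvd.mp h))
  rw [e1, e2]
  have hp0 : (0 : ℝ) ≤ (p : ℝ) ^ (-((s + 1 : ℕ) : ℤ)) := zpow_nonneg (Nat.cast_nonneg _) _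
  have hsq : (p : ℝ) ^ (-((2 * s + 2 : ℕ) : ℤ)) = ((p : ℝ) ^ (-((s + 1 : ℕ) : ℤ))) ^ 2 := by
    rw [← zpow_natCast ((p : ℝ) ^ (-((s + 1 : ℕ) : ℤ))) 2, ← zpow_mul]
    congr 1
    push_cast
    ring
  calc ‖((F.eval a : ℤ) : ℤ_[p])‖ ≤ (p : ℝ) ^ (-((2 * s + 2 : ℕ) : ℤ)) := h1
    _ = ((p : ℝ) ^ (-((s + 1 : ℕ) : ℤ))) ^ 2 := hsq
    _ < ‖((F.derivative.eval a : ℤ) : ℤ_[p])‖ ^ 2 :=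
        pow_lt_pow_left₀ (not_le.mp h2) hp0 two_ne_zero

/-- **A `p`-torsion point of `E(ℚ_p)` from the Hensel certificate (C1)–(C4).** `E₀/ℤ` an integral
Weierstrass equation, `p` an odd prime, `V = E₀ ⊗ ℚ_p` elliptic; if integers `a, b` and `s : ℕ`
satisfy (C1) `p^(2s+2) ∣ preΨ'_p(E₀)(a)`, (C2) `p^(2s+2) ∤ preΨ'_p(E₀)(a + p^(s+1))`,
(C3) `p ∤ 2b + a₁a + a₃`, (C4) `p ∣ b² + a₁ab + a₃b − (a³ + a₂a² + a₄a + a₆)` — each decidable through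
`PrePsiEval.prePsi` — then there is `P ∈ V(ℚ_p)`, `P ≠ O`, `p • P = O`: Hensel lifts `a` to a root
`ξ ∈ ℤ_p` of `preΨ'_p` and `b` to `η` with `(ξ, η) ∈ E₀(ℤ_p)`, and `ψ_p` vanishes exactly on
`E[p] ∖ O` (AEC Ex. 3.7(f)). [cite: SilvermanAEC2009, Exercise 3.7(f) (PDF p. 98)]
[cite: Kim2022StructureSelmer, Prop. 3.2 (PDF p. 15)] -/
theorem exists_ne_zero_prime_smul_eq_zero_of_henselCertificate (hp2 : p ≠ 2) (a b : ℤ) (s : ℕ)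
    (hC1 : (p : ℤ) ^ (2 * s + 2) ∣ PrePsiEval.prePsi W₀ a p)
    (hC2 : ¬ (p : ℤ) ^ (2 * s + 2) ∣ PrePsiEval.prePsi W₀ (a + (p : ℤ) ^ (s + 1)) p)
    (hC3 : ¬ (p : ℤ) ∣ 2 * b + W₀.a₁ * a + W₀.a₃)
    (hC4 : (p : ℤ) ∣ b ^ 2 + W₀.a₁ * a * b + W₀.a₃ * b - (a ^ 3 + W₀.a₂ * a ^ 2 + W₀.a₄ * a + W₀.a₆))
    (V : WeierstrassCurve ℚ_[p]) [V.IsElliptic] (hV : W₀.map (Int.castRingHom ℚ_[p]) = V) :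
    ∃ P : V.toAffine.Point, P ≠ 0 ∧ (p : ℤ) • P = 0 := by
  subst hV
  set F : ℤ[X] := W₀.preΨ' p with hF
  -- Step 1: the root `ξ ∈ ℤ_p` of `preΨ'_p`, `ξ ≡ a (mod p)`
  obtain ⟨ξ, hξ0, hξa, -, -⟩ :=
    hensels_lemma (norm_aeval_preΨ'_lt_sq_of_certificate W₀ p a s hC1 hC2)
  have hξa1 : ‖ξ - (a : ℤ_[p])‖ < 1 := lt_of_lt_of_le hξa (PadicInt.norm_le_one _)
  -- Step 2: the ordinate.  `g(X) = b² + (a₁X + a₃)b − (X³ + a₂X² + a₄X + a₆) ∈ ℤ[X]`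
  set g : ℤ[X] := C (b ^ 2) + (C W₀.a₁ * X + C W₀.a₃) * C b -
    (X ^ 3 + C W₀.a₂ * X ^ 2 + C W₀.a₄ * X + C W₀.a₆) with hg
  have hga : g.eval a =
      b ^ 2 + W₀.a₁ * a * b + W₀.a₃ * b - (a ^ 3 + W₀.a₂ * a ^ 2 + W₀.a₄ * a + W₀.a₆) := by
    simp only [hg, eval_add, eval_sub, eval_mul, eval_pow, eval_C, eval_X]
    ring
  set gp : ℤ_[p][X] := g.map (Int.castRingHom ℤ_[p]) with hgp
  have hgpa0 : gp.eval (a : ℤ_[p]) = ((g.eval a : ℤ) : ℤ_[p]) := by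
    rw [hgp, Polynomial.eval_intCast_map, Int.cast_id]
    rfl
  have hgpa : ‖gp.eval (a : ℤ_[p])‖ < 1 := by
    rw [hgpa0, hga]
    exact (PadicInt.norm_int_lt_one_iff_dvd _).mpr hC4
  have hgpξ : ‖gp.eval ξ‖ < 1 := by
    obtain ⟨t, ht⟩ := Polynomial.sub_dvd_eval_sub ξ (a : ℤ_[p]) gp
    have e : gp.eval ξ = gp.eval (a : ℤ_[p]) + (ξ - a) * t := by rw [← ht]; ring
    rw [e]
    refine lt_of_le_of_lt (PadicInt.nonarchimedean _ _) (max_lt hgpa ?_)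
    rw [norm_mul]
    exact lt_of_le_of_lt (mul_le_of_le_one_right (norm_nonneg _) (PadicInt.norm_le_one _)) hξa1
  -- the quadratic `G(Y) = Y² + (a₁ξ + a₃)Y − (ξ³ + a₂ξ² + a₄ξ + a₆) ∈ ℤ_p[Y]`
  set A₁ : ℤ_[p] := (W₀.a₁ : ℤ_[p])
  set A₂ : ℤ_[p] := (W₀.a₂ : ℤ_[p])
  set A₃ : ℤ_[p] := (W₀.a₃ : ℤ_[p])
  set A₄ : ℤ_[p] := (W₀.a₄ : ℤ_[p])
  set A₆ : ℤ_[p] := (W₀.a₆ : ℤ_[p])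
  set G : ℤ_[p][X] := X ^ 2 + C (A₁ * ξ + A₃) * X -
    C (ξ ^ 3 + A₂ * ξ ^ 2 + A₄ * ξ + A₆) with hG
  have hGeval : ∀ y : ℤ_[p], G.eval y =
      y ^ 2 + (A₁ * ξ + A₃) * y - (ξ ^ 3 + A₂ * ξ ^ 2 + A₄ * ξ + A₆) := by
    intro y
    simp only [hG, eval_add, eval_sub, eval_mul, eval_pow, eval_C, eval_X]
  have hGb : G.eval (b : ℤ_[p]) = gp.eval ξ := by
    rw [hGeval, hgp, Polynomial.eval_map, hg]
    simp only [eval₂_add, eval₂_sub, eval₂_mul, eval₂_pow, eval₂_C, eval₂_X]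
    simp only [eq_intCast, Int.cast_pow]
    rfl
  have hGder : ∀ y : ℤ_[p], G.derivative.eval y = 2 * y + (A₁ * ξ + A₃) := by
    intro y
    simp only [hG, derivative_add, derivative_sub, derivative_mul, derivative_X_pow, derivative_C,
      derivative_X, eval_add, eval_mul, eval_pow, eval_C, eval_X, eval_zero,
      Nat.cast_ofNat, zero_mul, sub_zero, mul_one]
    ring
  -- `‖G'(b)‖ = 1`
  have hunit : ‖2 * (b : ℤ_[p]) + (A₁ * ξ + A₃)‖ = 1 := by
    have e : 2 * (b : ℤ_[p]) + (A₁ * ξ + A₃) =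
        ((2 * b + W₀.a₁ * a + W₀.a₃ : ℤ) : ℤ_[p]) + A₁ * (ξ - a) := by
      push_cast
      ring
    have hc0 : ‖((2 * b + W₀.a₁ * a + W₀.a₃ : ℤ) : ℤ_[p])‖ = 1 :=
      le_antisymm (PadicInt.norm_le_one _)
        (not_lt.mp fun h => hC3 ((PadicInt.norm_int_lt_one_iff_dvd _).mp h))
    have he : ‖A₁ * (ξ - a)‖ < 1 := by
      rw [norm_mul]
      exact lt_of_le_of_lt (mul_le_of_le_one_left (norm_nonneg _) (PadicInt.norm_le_one _)) hξa1
    rw [e, PadicInt.norm_add_eq_max_of_ne (by rw [hc0]; exact (ne_of_lt he).symm), hc0]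
    exact max_eq_left he.le
  have hnormG : ‖Polynomial.aeval (b : ℤ_[p]) G‖ <
      ‖Polynomial.aeval (b : ℤ_[p]) (Polynomial.derivative G)‖ ^ 2 := by
    simp only [Polynomial.coe_aeval_eq_eval]
    rw [hGder, hunit, one_pow, hGb]
    exact hgpξ
  obtain ⟨η, hη0, -, -, -⟩ := hensels_lemma hnormG
  have hη : η ^ 2 + (A₁ * ξ + A₃) * η - (ξ ^ 3 + A₂ * ξ ^ 2 + A₄ * ξ + A₆) = 0 := by
    rw [← hGeval]
    simpa only [Polynomial.coe_aeval_eq_eval] using hη0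
  -- Step 3: `(ξ, η) ∈ E₀(ℤ_p)`, read in `ℚ_p`
  have heqZ : (W₀.map (Int.castRingHom ℤ_[p])).toAffine.Equation ξ η := by
    rw [WeierstrassCurve.Affine.equation_iff]
    simp only [WeierstrassCurve.map_a₁, WeierstrassCurve.map_a₂, WeierstrassCurve.map_a₃,
      WeierstrassCurve.map_a₄, WeierstrassCurve.map_a₆, eq_intCast]
    linear_combination hη
  set ι : ℤ_[p] →+* ℚ_[p] := PadicInt.Coe.ringHom (p := p) with hι
  have hcurve : (W₀.map (Int.castRingHom ℤ_[p])).map ι = W₀.map (Int.castRingHom ℚ_[p]) := by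
    rw [WeierstrassCurve.map_map]
    exact congrArg W₀.map (RingHom.ext_int _ _)
  have heqQ : (W₀.map (Int.castRingHom ℚ_[p])).toAffine.Equation (ι ξ) (ι η) := by
    rw [← hcurve]
    exact WeierstrassCurve.Affine.Equation.map ι heqZ
  have hns : (W₀.map (Int.castRingHom ℚ_[p])).toAffine.Nonsingular (ι ξ) (ι η) :=
    (WeierstrassCurve.Affine.equation_iff_nonsingular).mp heqQ
  refine ⟨WeierstrassCurve.Affine.Point.some _ _ hns, WeierstrassCurve.Affine.Point.some_ne_zero _, ?_⟩
  -- Step 4: `p • P = O` since `ΨSq_p(ξ) = preΨ'_p(ξ)² = 0`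
  rw [(W₀.map (Int.castRingHom ℚ_[p])).zsmul_some_eq_zero_iff_eval_ΨSq hns p]
  have hodd : ¬ Even p := by
    intro he
    exact hp2 ((Nat.Prime.even_iff hp.out).mp he)
  rw [WeierstrassCurve.ΨSq_ofNat, if_neg hodd, mul_one, eval_pow, WeierstrassCurve.map_preΨ']
  have e3 : (W₀.preΨ' p).map (Int.castRingHom ℚ_[p]) = (F.map (Int.castRingHom ℤ_[p])).map ι := by
    rw [Polynomial.map_map]
    exact congrArg (Polynomial.map · (W₀.preΨ' p)) (RingHom.ext_int _ _)
  have e4 : (F.map (Int.castRingHom ℤ_[p])).eval ξ = 0 := by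
    rw [Polynomial.eval_map, ← algebraMap_int_eq, ← Polynomial.aeval_def]
    exact hξ0
  rw [e3, Polynomial.eval_map, Polynomial.eval₂_at_apply, e4, map_zero, zero_pow two_ne_zero]

/-- The `ℚ_p`-base change of the rational curve of `E₀/ℤ` is `E₀` read in `ℚ_p`. [folklore] -/
private theorem baseChange_map_intCast_rat_eq_map' :
    (W₀.map (Int.castRingHom ℚ)).baseChange ℚ_[p] = W₀.map (Int.castRingHom ℚ_[p]) := by
  rw [WeierstrassCurve.baseChange, WeierstrassCurve.map_map]
  exact congrArg W₀.map (RingHom.ext_int _ _)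

/-- **`#E(ℚ_p)[p] ≠ 1` from the Hensel certificate** — the negation of the `(t0)` binder shape
`natCard_localPTorsion_eq_one_of_certificate` (`Nat.card {Q // p • Q = 0} = 1`): for `E/ℚ` elliptic
with integral equation `E₀` (`E₀ ⊗ ℚ = E`), `p` odd, and integers `a, b`, `s : ℕ` satisfying
(C1)–(C4), the `p`-torsion of `E(ℚ_p)` is non-trivial (Kim's `t = 1`).
[cite: SilvermanAEC2009, Exercise 3.7(f) (PDF p. 98)] [cite: Kim2022StructureSelmer, Prop. 3.2 (PDF p. 15)] -/
theorem natCard_localPTorsion_ne_one_of_henselCertificate (hp2 : p ≠ 2) (W : WeierstrassCurve ℚ)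
    [W.IsElliptic] (hW : W₀.map (Int.castRingHom ℚ) = W) (a b : ℤ) (s : ℕ)
    (hC1 : (p : ℤ) ^ (2 * s + 2) ∣ PrePsiEval.prePsi W₀ a p)
    (hC2 : ¬ (p : ℤ) ^ (2 * s + 2) ∣ PrePsiEval.prePsi W₀ (a + (p : ℤ) ^ (s + 1)) p)
    (hC3 : ¬ (p : ℤ) ∣ 2 * b + W₀.a₁ * a + W₀.a₃)
    (hC4 : (p : ℤ) ∣ b ^ 2 + W₀.a₁ * a * b + W₀.a₃ * b - (a ^ 3 + W₀.a₂ * a ^ 2 + W₀.a₄ * a + W₀.a₆)) :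
    Nat.card {Q : (W.baseChange ℚ_[p]).toAffine.Point // (p : ℕ) • Q = 0} ≠ 1 := by
  subst hW
  obtain ⟨P, hP0, hP⟩ := exists_ne_zero_prime_smul_eq_zero_of_henselCertificate W₀ p hp2 a b s
    hC1 hC2 hC3 hC4 _ (baseChange_map_intCast_rat_eq_map' W₀ p).symm
  intro h1
  have hsub := (Nat.card_eq_one_iff_unique.mp h1).1
  have hPn : (p : ℕ) • P = 0 := by rwa [← natCast_zsmul]
  have h0 : (p : ℕ) • (0 : ((W₀.map (Int.castRingHom ℚ)).baseChange ℚ_[p]).toAffine.Point) = 0 :=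
    nsmul_zero _
  exact hP0 (congrArg Subtype.val (hsub.elim ⟨P, hPn⟩ ⟨0, h0⟩))

/-- **Existence form over `ℚ`**: under (C1)–(C4), `E(ℚ_p)` has a point `P ≠ O` with `p • P = O`
(`E = E₀ ⊗ ℚ`). [cite: SilvermanAEC2009, Exercise 3.7(f) (PDF p. 98)]
[cite: Kim2022StructureSelmer, Prop. 3.2 (PDF p. 15)] -/
theorem exists_localPTorsion_ne_zero_of_henselCertificate (hp2 : p ≠ 2) (W : WeierstrassCurve ℚ)
    [W.IsElliptic] (hW : W₀.map (Int.castRingHom ℚ) = W) (a b : ℤ) (s : ℕ)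
    (hC1 : (p : ℤ) ^ (2 * s + 2) ∣ PrePsiEval.prePsi W₀ a p)
    (hC2 : ¬ (p : ℤ) ^ (2 * s + 2) ∣ PrePsiEval.prePsi W₀ (a + (p : ℤ) ^ (s + 1)) p)
    (hC3 : ¬ (p : ℤ) ∣ 2 * b + W₀.a₁ * a + W₀.a₃)
    (hC4 : (p : ℤ) ∣ b ^ 2 + W₀.a₁ * a * b + W₀.a₃ * b - (a ^ 3 + W₀.a₂ * a ^ 2 + W₀.a₄ * a + W₀.a₆)) :
    ∃ P : (W.baseChange ℚ_[p]).toAffine.Point, P ≠ 0 ∧ (p : ℕ) • P = 0 := by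
  subst hW
  obtain ⟨P, hP0, hP⟩ := exists_ne_zero_prime_smul_eq_zero_of_henselCertificate W₀ p hp2 a b s
    hC1 hC2 hC3 hC4 _ (baseChange_map_intCast_rat_eq_map' W₀ p).symm
  exact ⟨P, hP0, by rwa [← natCast_zsmul]⟩

end HenselCertificate

end Literature.NumberTheory.EllipticCurves
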